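import Summits.CriticalPhenomena.PercolationContinuityZ3.Theses.PercNearOneGluing
import Literature.Probability.Percolation.PercolationEvents
import HarnessLib.Audit
import Literature.Probability.LatticeModels.ProdBernoulliIndependence

/-! TTRL-lite variant V2407 of stmt-CriticalPhenomena-4574

(`stub_shorteningStep` of line `kn_shortening_induction`, move `small_case`: `A.card ≤ 1`).  With a
single relay (`A = {a₀}`, forced by `a₀ ∈ A` and `A.card ≤ 1`) the union `⋃ a ∈ A, {v ↔ a}` is just
`{v ↔ a₀}`, and the Kozma–Nitzan shortening inequality degenerates to the Harris–FKG inequality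
`μ(v ↔ a₀) μ(a₀ ↔ b) ≤ μ({v ↔ a₀} ∩ {a₀ ↔ b}) ≤ μ(v ↔ b)` for the product measure
`μ = prodBernoulli (w[s(v,x) ↦ 1])` (`prodBernoulli_harris`, both connection events being increasing,
`isUpperSet_openConn`).  The induction hypothesis, the minimiser hypothesis and `w s(v,x) = 0` are not
used.  No new definitions, no named facts. -/

namespace Summit.CriticalPhenomena.PercolationContinuityZ3.Theorems

open MeasureTheory Set Literature.Probability.LatticeModels Literature.Probability.Percolation
open scoped Classical BigOperators

/-- TTRL-lite variant V2407 of `stub_shorteningStep` (stmt-CriticalPhenomena-4574, Kozma–Nitzan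
Conjecture 6 with induction hypothesis): the one-relay case `A.card ≤ 1`.  Since `a₀ ∈ A` forces
`A = {a₀}`, the claim is `μ(v ↔ a₀) · μ(a₀ ↔ b) ≤ μ(v ↔ b)`, which is Harris' inequality for the two
increasing events `{v ↔ a₀}`, `{a₀ ↔ b}` followed by `{v ↔ a₀} ∩ {a₀ ↔ b} ⊆ {v ↔ b}`. -/
theorem stub_shorteningStep_var2407 : ∀ (n : ℕ) (w : Sym2 (Fin n) → unitInterval) (A : Finset (Fin n)) (b v x a₀ : Fin n), A.card ≤ 1 → v ∉ A → v ≠ x → w s(v, x) = 0 → a₀ ∈ A → (∀ a ∈ A, (prodBernoulli w).real (openConn a₀ b) ≤ (prodBernoulli w).real (openConn a b)) → (∀ w' : Sym2 (Fin n) → unitInterval, (∀ e, w e = 0 → w' e = 0) → ∀ (A' : Finset (Fin n)) (o' b' : Fin n) (t : ℝ), (∀ a ∈ A', t ≤ (prodBernoulli w').real (openConn a b')) → (prodBernoulli w').real (⋃ a ∈ A', openConn o' a) * t ≤ (prodBernoulli w').real (openConn o' b')) → (prodBernoulli (Function.update w s(v, x) 1)).real (⋃ a ∈ A, openConn v a)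 * (prodBernoulli (Function.update w s(v, x) 1)).real (openConn a₀ b) ≤ (prodBernoulli (Function.update w s(v, x) 1)).real (openConn v b) := by
  intro n w A b v x a₀ hA _hvA _hvx _hw0 ha₀ _hmin _hIH
  -- `A = {a₀}`
  have hAeq : A = {a₀} := by
    obtain ⟨B, hBA, ha₀B, hBcard⟩ : ∃ B ⊆ A, a₀ ∈ B ∧ B.card = 1 :=
      ⟨{a₀}, Finset.singleton_subset_iff.2 ha₀, Finset.mem_singleton_self a₀, Finset.card_singleton a₀⟩
    have hAB : A = B := (Finset.eq_of_subset_of_card_le hBA (hBcard ▸ hA)).symm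
    rw [Finset.card_eq_one] at hBcard
    obtain ⟨c, hc⟩ := hBcard
    rw [hc, Finset.mem_singleton] at ha₀B
    rw [hAB, hc, ha₀B]
  -- the union collapses to a single connection event
  have hU : (⋃ a ∈ A, openConn v a : Set (BondConfig (Fin n))) = openConn v a₀ := by
    ext ω
    simp only [hAeq, Finset.mem_singleton, mem_iUnion, exists_prop, exists_eq_left]
  rw [hU]
  -- Harris' inequality for the two increasing connection events, then transitivity
  have hsub : (openConn v a₀ ∩ openConn a₀ b : Set (BondConfig (Fin n))) ⊆ openConn v b :=
    fun ω hω => SimpleGraph.Reachable.trans hω.1 hω.2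
  calc (prodBernoulli (Function.update w s(v, x) 1)).real (openConn v a₀) *
        (prodBernoulli (Function.update w s(v, x) 1)).real (openConn a₀ b)
      ≤ (prodBernoulli (Function.update w s(v, x) 1)).real (openConn v a₀ ∩ openConn a₀ b) :=
        prodBernoulli_harris _ (isUpperSet_openConn v a₀) (isUpperSet_openConn a₀ b)
          (Set.toFinite _).measurableSet (Set.toFinite _).measurableSet
    _ ≤ (prodBernoulli (Function.update w s(v, x) 1)).real (openConn v b) := measureReal_mono hsub

end Summit.CriticalPhenomena.PercolationContinuityZ3.Theorems
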